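import Summits.Ventures.HodgeRepro2.T5InertTopCoefficient

/-!
# The three-term recurrence of the spherical Hecke algebra at an inert place
(cell pub-hodge-repro2, seat p3)

Tier-5 N3 support. Seat p8's T5-187 filters `H(U(antidiag(1, u, 1)), K)` by the cells from above:
`T_j · Tₙ ∈ span(T₀, …, T_{n+j})` (`ϖ^{n+j}` clears every product). Here the filtration is bounded from
BELOW as well — the coefficient of `T_m` in `T_j · Tₙ` vanishes unless `n − j ≤ m ≤ n + j`:

* `clears_inv` — for `g ∈ U(J₃(u))`, `d` clears `g⁻¹` whenever `d` clears `g` (the unitary relation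
  `g⁻¹ = J₃(u)⁻¹ gᴴ J₃(u)`, the star preserving integrality, `u`, `u⁻¹` integral);
* `le_add_of_mem_orbit_of_mul_mem_orbit` — `g ∈ K aₙ K` and `g⁻¹ a_m ∈ K a_j K` force `n ≤ m + j`
  (`g = a_m · (g⁻¹ a_m)⁻¹` is cleared by `ϖ^{m+j}`, and `ϖ^l` clears `K aₙ K` only when `n ≤ l`);
* **`coeff_mul_cellU_eq_zero_of_lt`** — `m + j < n ⇒ ((T_j Tₙ) δ_K)(a_m K) = 0` (T5-5x's structure-constant
  count is over an empty set);
* `eq_add_add_of_eq_sum` / `X_mul_eq_of_mul_eq` (abstract, T5-180's setting) and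
  **`mul_cellU_eq_three_term`** — `T₁ · T_{n+1} = T_{n+2} + c · T_{n+1} + d · Tₙ` with
  `c = ((T₁ T_{n+1}) δ_K)(a_{n+1} K)` and `d = ((T₁ T_{n+1}) δ_K)(aₙ K)` (the top coefficient is `1` by file
  187; the coefficients below `Tₙ` vanish by the bound above);
* **`X_mul_eq_of_aeval_eq`** — the monic Hecke polynomials of file 188 satisfy the same three-term
  recurrence: `X · P_{n+1} = P_{n+2} + c · P_{n+1} + d · Pₙ`, i.e. `P_{n+2} = (X − c) · P_{n+1} − d · Pₙ`.

What stays prose of this chain: the VALUES `c = q − 1` and `d = q⁴` (`q = #(R/ϖ)`; `d = q⁴ + q` for `n = 0`)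
— the counts of the `K`-cosets in `K aₙ K` at tree distance `2` from `a_{n+1} K` and `a_{n−1} K`, which
need explicit coset representatives — and the Satake normalisation `T₁ ↔ q²(X + X⁻¹) + (q − 1)`.

Mathlib + this seat's file 187 + seat p8's T5-5x / T5-134 / T5-136 / T5-187 and their imports; no
display; no device. §8(d): uses an L-value-free non-vanishing device: NO.
-/

namespace Summit.Ventures.HodgeRepro2.T5InertThreeTermRecurrence

open Summit.Ventures.HodgeRepro2.T5CartanCellsDistinct Summit.Ventures.HodgeRepro2.T5HeckeBasisCells
  Summit.Ventures.HodgeRepro2.T5HermitianThreeElements Summit.Ventures.HodgeRepro2.T5UnitaryGroupForm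
  Summit.Ventures.HodgeRepro2.T5UnitaryHeckeAdjoint Summit.Ventures.HodgeRepro2.T5HeckeDoubleCoset
  Summit.Ventures.HodgeRepro2.T5HeckeConvolution Summit.Ventures.HodgeRepro2.T5HeckePermutationModule
  Summit.Ventures.HodgeRepro2.T5HeckeCellFiltration Summit.Ventures.HodgeRepro2.T5HeckePolynomialAlgebra
  Summit.Ventures.HodgeRepro2.T5InertTopCoefficient

/-! ## Clearing the inverse of a unitary matrix -/

section Inverse

variable {R E : Type*} [CommRing R] [Field E] [StarRing E] [Algebra R E]

omit [StarRing E] in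
/-- The entries of `antidiag(1, a, 1)` are integral when `a` is. -/
theorem isInteger_antidiag_apply {a : E} (ha : IsLocalization.IsInteger R a) (i j : Fin 3) :
    IsLocalization.IsInteger R ((!![0, 0, 1; 0, a, 0; 1, 0, 0] : Matrix (Fin 3) (Fin 3) E) i j) := by
  fin_cases i <;> fin_cases j <;>
    simp only [Fin.zero_eta, Fin.mk_one, Fin.reduceFinMk, Fin.isValue, Matrix.of_apply, Matrix.cons_val',
      Matrix.cons_val_zero, Matrix.cons_val_one, Matrix.head_cons, Matrix.cons_val_two, Matrix.tail_cons,
      Matrix.empty_val', Matrix.cons_val_fin_one]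
  all_goals first
    | exact IsLocalization.isInteger_zero
    | exact IsLocalization.isInteger_one
    | exact ha

variable (hstar : ∀ x : E, IsLocalization.IsInteger R x → IsLocalization.IsInteger R (star x))

include hstar in
/-- If `d` clears `g` and `star d = d`, then `d` clears the conjugate transpose `gᴴ`. -/
theorem clears_conjTranspose {d : E} (hd : star d = d) {g : Matrix (Fin 3) (Fin 3) E}
    (h : Clears R d g) : Clears R d g.conjTranspose := by
  rw [clears_iff] at h ⊢
  intro i j
  rw [Matrix.conjTranspose_apply]
  have := hstar _ (h j i)
  rwa [star_mul', hd] at this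

/-- The inverse of `g ∈ U(J₃(u))`: `g⁻¹ = J₃(u)⁻¹ · gᴴ · J₃(u)`. -/
theorem coe_inv_eq_of_mem {u : E} (hu0 : u ≠ 0) {g : GL (Fin 3) E} (hg : g ∈ formUnitaryGroup (J3 u)) :
    ((g⁻¹ : GL (Fin 3) E) : Matrix (Fin 3) (Fin 3) E) =
      !![0, 0, 1; 0, u⁻¹, 0; 1, 0, 0] * (g : Matrix (Fin 3) (Fin 3) E).conjTranspose * J3 u := by
  rw [Matrix.coe_units_inv]
  refine Matrix.inv_eq_right_inv ?_
  rw [← mul_assoc, ← mul_assoc, mul_Jinv_conjTranspose u hu0 hg, J3_eq, J3inv_mul_J3 u hu0]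

include hstar in
/-- **Clearing the inverse**: for `g ∈ U(J₃(u))` and `star d = d`, `d` clears `g⁻¹` as soon as it
clears `g`. -/
theorem clears_inv {u : E} (hu0 : u ≠ 0) (hu : IsLocalization.IsInteger R u)
    (hu' : IsLocalization.IsInteger R u⁻¹) {d : E} (hd : star d = d) {g : GL (Fin 3) E}
    (hg : g ∈ formUnitaryGroup (J3 u)) (h : Clears R d (g : Matrix (Fin 3) (Fin 3) E)) :
    Clears R d ((g⁻¹ : GL (Fin 3) E) : Matrix (Fin 3) (Fin 3) E) := by
  rw [coe_inv_eq_of_mem hu0 hg]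
  refine Clears.mul_right ?_ ?_
  · exact Clears.mul_left (clears_conjTranspose hstar hd h) (isInteger_antidiag_apply hu')
  · rw [J3_eq]
    exact isInteger_antidiag_apply hu

end Inverse

/-! ## The lower bound on the support of `T_j · Tₙ` -/

section Support

variable {R E : Type*} [CommRing R] [Field E] [StarRing E] [Algebra R E] [IsFractionRing R E]
  (hstar : ∀ x : E, IsLocalization.IsInteger R x → IsLocalization.IsInteger R (star x))
  (u : E) (hu0 : u ≠ 0) (hu : IsLocalization.IsInteger R u) (hu' : IsLocalization.IsInteger R u⁻¹)
  {ϖ : R} (hϖ : Irreducible ϖ) (hs : star (algebraMap R E ϖ) = algebraMap R E ϖ)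

include hstar hu0 hu hu' in
/-- `ϖ^m` clears `g⁻¹` for every `g ∈ K a_m K`. -/
theorem clears_pow_inv_of_mem_orbit_cellU {g : formUnitaryGroup (J3 u)} {m : ℕ}
    (hg : ((g : formUnitaryGroup (J3 u)) : formUnitaryGroup (J3 u) ⧸ hyperspecialSubgroup R (J3 u)) ∈
      MulAction.orbit (hyperspecialSubgroup R (J3 u))
        ((cellU hϖ hs u m : formUnitaryGroup (J3 u)) :
          formUnitaryGroup (J3 u) ⧸ hyperspecialSubgroup R (J3 u))) :
    Clears R (algebraMap R E ϖ ^ (m : ℤ))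
      (((g⁻¹ : formUnitaryGroup (J3 u)) : GL (Fin 3) E) : Matrix (Fin 3) (Fin 3) E) := by
  have h := clears_pow_of_mem_orbit_cellU u hϖ hs hg
  rw [Subgroup.coe_inv]
  exact clears_inv hstar hu0 hu hu' (by rw [star_zpow₀, hs]) g.2 h

include hstar hu0 hu hu' in
/-- **The lower bound**: `g ∈ K aₙ K` and `g⁻¹ a_m ∈ K a_j K` force `n ≤ m + j`. -/
theorem le_add_of_mem_orbit_of_mul_mem_orbit {g : formUnitaryGroup (J3 u)} {n m j : ℕ}
    (hg : ((g : formUnitaryGroup (J3 u)) : formUnitaryGroup (J3 u) ⧸ hyperspecialSubgroup R (J3 u)) ∈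
      MulAction.orbit (hyperspecialSubgroup R (J3 u))
        ((cellU hϖ hs u n : formUnitaryGroup (J3 u)) :
          formUnitaryGroup (J3 u) ⧸ hyperspecialSubgroup R (J3 u)))
    (h : ((g⁻¹ * cellU hϖ hs u m : formUnitaryGroup (J3 u)) :
        formUnitaryGroup (J3 u) ⧸ hyperspecialSubgroup R (J3 u)) ∈
      MulAction.orbit (hyperspecialSubgroup R (J3 u))
        ((cellU hϖ hs u j : formUnitaryGroup (J3 u)) :
          formUnitaryGroup (J3 u) ⧸ hyperspecialSubgroup R (J3 u))) :
    n ≤ m + j := by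
  -- `ϖ^j` clears `(g⁻¹ a_m)⁻¹ = a_m⁻¹ g`
  have h1 := clears_pow_inv_of_mem_orbit_cellU hstar u hu0 hu hu' hϖ hs h
  -- `ϖ^m` clears `a_m`
  have h2 : Clears R (algebraMap R E ϖ ^ (m : ℤ))
      (((cellU hϖ hs u m : formUnitaryGroup (J3 u)) : GL (Fin 3) E) : Matrix (Fin 3) (Fin 3) E) := by
    rw [coe_cellU]
    exact (clears_pow_cell_iff hϖ m m).2 le_rfl
  -- hence `ϖ^{m+j}` clears `a_m · (a_m⁻¹ g) = g`
  have h3 := clears_mul h2 h1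
  have hϖ0 : algebraMap R E ϖ ≠ 0 := by
    rw [ne_eq, map_eq_zero_iff _ (IsFractionRing.injective R E)]
    exact hϖ.ne_zero
  have h4 : Clears R (algebraMap R E ϖ ^ ((m + j : ℕ) : ℤ))
      (((g : formUnitaryGroup (J3 u)) : GL (Fin 3) E) : Matrix (Fin 3) (Fin 3) E) := by
    rw [Nat.cast_add, zpow_add₀ hϖ0]
    convert h3 using 1
    rw [mul_inv_rev, inv_inv, ← Units.val_mul, ← Subgroup.coe_mul, mul_inv_cancel_left]
  exact le_of_clears_pow_of_mem_orbit_cellU u hϖ hs h4 hg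

variable [IsDomain R] [IsDiscreteValuationRing R] [Finite (IsLocalRing.ResidueField R)]

include hstar hu0 hu hu' in
/-- **The support of `T_j · Tₙ` from below**: the structure constant at `a_m K` vanishes when
`m + j < n` (T5-5x's coset count is over an empty set). -/
theorem coeff_mul_cellU_eq_zero_of_lt (k : Type*) [Field k] {j n m : ℕ} (hlt : m + j < n) :
    (((doubleCosetOp k (hyperspecialSubgroup R (J3 u)) (cellU hϖ hs u j) *
        doubleCosetOp k (hyperspecialSubgroup R (J3 u)) (cellU hϖ hs u n) :
        heckeAlgebra k (hyperspecialSubgroup R (J3 u))) :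
        Module.End k (MonoidAlgebra k (formUnitaryGroup (J3 u) ⧸ hyperspecialSubgroup R (J3 u))))
      (MonoidAlgebra.single ((1 : formUnitaryGroup (J3 u)) :
        formUnitaryGroup (J3 u) ⧸ hyperspecialSubgroup R (J3 u)) 1)).coeff
      ((cellU hϖ hs u m : formUnitaryGroup (J3 u)) :
        formUnitaryGroup (J3 u) ⧸ hyperspecialSubgroup R (J3 u)) = 0 := by
  set K := hyperspecialSubgroup R (J3 u) with hK
  rw [coeff_doubleCosetOp_mul_apply_single_one]
  have hempty : MulAction.orbit K ((cellU hϖ hs u n : formUnitaryGroup (J3 u)) : formUnitaryGroup (J3 u) ⧸ K) ∩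
      {x | ((Quotient.out x)⁻¹ • ((cellU hϖ hs u m : formUnitaryGroup (J3 u)) :
          formUnitaryGroup (J3 u) ⧸ K) : formUnitaryGroup (J3 u) ⧸ K) ∈
        MulAction.orbit K ((cellU hϖ hs u j : formUnitaryGroup (J3 u)) : formUnitaryGroup (J3 u) ⧸ K)} =
      ∅ := by
    rw [Set.eq_empty_iff_forall_notMem]
    rintro x ⟨hx1, hx2⟩
    have hout : ((Quotient.out x : formUnitaryGroup (J3 u)) : formUnitaryGroup (J3 u) ⧸ K) = x :=
      QuotientGroup.out_eq' x
    rw [← hout] at hx1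
    have hx2' : (((Quotient.out x)⁻¹ * cellU hϖ hs u m : formUnitaryGroup (J3 u)) :
        formUnitaryGroup (J3 u) ⧸ K) ∈
        MulAction.orbit K ((cellU hϖ hs u j : formUnitaryGroup (J3 u)) : formUnitaryGroup (J3 u) ⧸ K) := by
      have := hx2
      simp only [Set.mem_setOf_eq] at this
      rwa [MulAction.Quotient.smul_mk, smul_eq_mul] at this
    have := le_add_of_mem_orbit_of_mul_mem_orbit hstar u hu0 hu hu' hϖ hs hx1 hx2'
    omega
  rw [hempty, Set.ncard_empty, Nat.cast_zero]

end Support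

/-! ## The three-term recurrence -/

section AbstractThreeTerm

variable {k : Type*} [Field k] {B : Type*} [Ring B] [Algebra k B] {A : Subalgebra k B}
  (T : Module.Basis ℕ k A)

/-- **Collapsing a cell expansion to three terms** (abstract): if `x = Σ_{m < n+3} c m • T m` with
`c m = 0` for `m < n` and `c (n+2) = 1`, then `x = T (n+2) + c (n+1) • T (n+1) + c n • T n`. -/
theorem eq_add_add_of_eq_sum {x : A} {c : ℕ → k} {n : ℕ}
    (h : x = ∑ m ∈ Finset.range (n + 1 + 1 + 1), c m • T m) (hc : ∀ m < n, c m = 0)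
    (htop : c (n + 1 + 1) = 1) :
    x = T (n + 1 + 1) + c (n + 1) • T (n + 1) + c n • T n := by
  rw [h, Finset.sum_range_succ, Finset.sum_range_succ, Finset.sum_range_succ, htop, one_smul,
    Finset.sum_eq_zero fun m hm => by rw [hc m (Finset.mem_range.1 hm), zero_smul], zero_add]
  abel

variable (hT0 : T 0 = 1)
  (hlead : ∀ n : ℕ, T 1 * T n - T (n + 1) ∈ Submodule.span k (T '' {i | i < n + 1}))

include hT0 hlead in
/-- **The polynomial recurrence** (abstract): if `T 1 * T (n+1) = T (n+2) + c • T (n+1) + d • T n` and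
`P, Q, S` are the polynomials of `T n, T (n+1), T (n+2)`, then `X · Q = S + C c · Q + C d · P`. -/
theorem X_mul_eq_of_mul_eq {n : ℕ} {c d : k}
    (hx : T 1 * T (n + 1) = T (n + 1 + 1) + c • T (n + 1) + d • T n) {P Q S : Polynomial k}
    (hP : Polynomial.aeval (T 1) P = T n) (hQ : Polynomial.aeval (T 1) Q = T (n + 1))
    (hS : Polynomial.aeval (T 1) S = T (n + 1 + 1)) :
    Polynomial.X * Q = S + Polynomial.C c * Q + Polynomial.C d * P := by
  apply (aeval_bijective T hT0 hlead).1
  rw [map_mul, map_add, map_add, map_mul, map_mul, Polynomial.aeval_X, Polynomial.aeval_C,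
    Polynomial.aeval_C, hP, hQ, hS, Algebra.algebraMap_eq_smul_one, Algebra.algebraMap_eq_smul_one,
    smul_mul_assoc, smul_mul_assoc, one_mul, one_mul]
  exact hx

end AbstractThreeTerm

section ThreeTerm

variable {R E : Type*} [CommRing R] [Field E] [StarRing E] [Algebra R E] [IsFractionRing R E] [IsDomain R]
  [IsDiscreteValuationRing R] [Finite (IsLocalRing.ResidueField R)]
  (hstar : ∀ x : E, IsLocalization.IsInteger R x → IsLocalization.IsInteger R (star x))
  (u : E) (hsu : star u = u) (hu0 : u ≠ 0) (hu : IsLocalization.IsInteger R u)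
  (hu' : IsLocalization.IsInteger R u⁻¹) {ϖ : R} (hϖ : Irreducible ϖ)
  (hs : star (algebraMap R E ϖ) = algebraMap R E ϖ) (k : Type*) [Field k]

/-- **The three-term recurrence in `H(U(J₃(u)), K)`**: `T₁ · T_{n+1} = T_{n+2} + c · T_{n+1} + d · Tₙ`, with
`c = ((T₁ T_{n+1}) δ_K)(a_{n+1} K)` and `d = ((T₁ T_{n+1}) δ_K)(aₙ K)` the two structure constants that
survive (the top coefficient is `1` by file 187, the coefficients below `Tₙ` vanish by the lower bound). -/
theorem mul_cellU_eq_three_term (n : ℕ) :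
    heckeBasisCells hstar u hsu hu0 hu hu' hϖ hs k 1 * heckeBasisCells hstar u hsu hu0 hu hu' hϖ hs k (n + 1) =
      heckeBasisCells hstar u hsu hu0 hu hu' hϖ hs k (n + 1 + 1) +
        (((doubleCosetOp k (hyperspecialSubgroup R (J3 u)) (cellU hϖ hs u 1) *
            doubleCosetOp k (hyperspecialSubgroup R (J3 u)) (cellU hϖ hs u (n + 1)) :
            heckeAlgebra k (hyperspecialSubgroup R (J3 u))) :
            Module.End k (MonoidAlgebra k (formUnitaryGroup (J3 u) ⧸ hyperspecialSubgroup R (J3 u))))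
          (MonoidAlgebra.single ((1 : formUnitaryGroup (J3 u)) :
            formUnitaryGroup (J3 u) ⧸ hyperspecialSubgroup R (J3 u)) 1)).coeff
          ((cellU hϖ hs u (n + 1) : formUnitaryGroup (J3 u)) :
            formUnitaryGroup (J3 u) ⧸ hyperspecialSubgroup R (J3 u)) •
          heckeBasisCells hstar u hsu hu0 hu hu' hϖ hs k (n + 1) +
        (((doubleCosetOp k (hyperspecialSubgroup R (J3 u)) (cellU hϖ hs u 1) *
            doubleCosetOp k (hyperspecialSubgroup R (J3 u)) (cellU hϖ hs u (n + 1)) :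
            heckeAlgebra k (hyperspecialSubgroup R (J3 u))) :
            Module.End k (MonoidAlgebra k (formUnitaryGroup (J3 u) ⧸ hyperspecialSubgroup R (J3 u))))
          (MonoidAlgebra.single ((1 : formUnitaryGroup (J3 u)) :
            formUnitaryGroup (J3 u) ⧸ hyperspecialSubgroup R (J3 u)) 1)).coeff
          ((cellU hϖ hs u n : formUnitaryGroup (J3 u)) :
            formUnitaryGroup (J3 u) ⧸ hyperspecialSubgroup R (J3 u)) •
          heckeBasisCells hstar u hsu hu0 hu hu' hϖ hs k n :=
  eq_add_add_of_eq_sum (heckeBasisCells hstar u hsu hu0 hu hu' hϖ hs k)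
    (c := fun m => (((doubleCosetOp k (hyperspecialSubgroup R (J3 u)) (cellU hϖ hs u 1) *
        doubleCosetOp k (hyperspecialSubgroup R (J3 u)) (cellU hϖ hs u (n + 1)) :
        heckeAlgebra k (hyperspecialSubgroup R (J3 u))) :
        Module.End k (MonoidAlgebra k (formUnitaryGroup (J3 u) ⧸ hyperspecialSubgroup R (J3 u))))
      (MonoidAlgebra.single ((1 : formUnitaryGroup (J3 u)) :
        formUnitaryGroup (J3 u) ⧸ hyperspecialSubgroup R (J3 u)) 1)).coeff
      ((cellU hϖ hs u m : formUnitaryGroup (J3 u)) :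
        formUnitaryGroup (J3 u) ⧸ hyperspecialSubgroup R (J3 u)))
    (mul_cellU_eq_sum hstar u hsu hu0 hu hu' hϖ hs k 1 (n + 1))
    (fun m hm => coeff_mul_cellU_eq_zero_of_lt hstar u hu0 hu hu' hϖ hs k (j := 1) (n := n + 1) (m := m)
      (by omega))
    (top_coeff_eq_one hstar u hu0 hu hu' hϖ hs k (n + 1))

/-- **The three-term recurrence of the monic Hecke polynomials**: if `P(T₁) = Tₙ`, `Q(T₁) = T_{n+1}` and
`S(T₁) = T_{n+2}`, then `X · Q = S + C c · Q + C d · P`, i.e. `S = (X − c) · Q − d · P`, with `c`, `d` the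
structure constants of `mul_cellU_eq_three_term` (injectivity of `aeval T₁`, file 187). -/
theorem X_mul_eq_of_aeval_eq {n : ℕ} {P Q S : Polynomial k}
    (hP : Polynomial.aeval (heckeBasisCells hstar u hsu hu0 hu hu' hϖ hs k 1) P =
      heckeBasisCells hstar u hsu hu0 hu hu' hϖ hs k n)
    (hQ : Polynomial.aeval (heckeBasisCells hstar u hsu hu0 hu hu' hϖ hs k 1) Q =
      heckeBasisCells hstar u hsu hu0 hu hu' hϖ hs k (n + 1))
    (hS : Polynomial.aeval (heckeBasisCells hstar u hsu hu0 hu hu' hϖ hs k 1) S =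
      heckeBasisCells hstar u hsu hu0 hu hu' hϖ hs k (n + 1 + 1)) :
    Polynomial.X * Q =
      S + Polynomial.C
          ((((doubleCosetOp k (hyperspecialSubgroup R (J3 u)) (cellU hϖ hs u 1) *
              doubleCosetOp k (hyperspecialSubgroup R (J3 u)) (cellU hϖ hs u (n + 1)) :
              heckeAlgebra k (hyperspecialSubgroup R (J3 u))) :
              Module.End k (MonoidAlgebra k (formUnitaryGroup (J3 u) ⧸ hyperspecialSubgroup R (J3 u))))
            (MonoidAlgebra.single ((1 : formUnitaryGroup (J3 u)) :
              formUnitaryGroup (J3 u) ⧸ hyperspecialSubgroup R (J3 u)) 1)).coeff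
            ((cellU hϖ hs u (n + 1) : formUnitaryGroup (J3 u)) :
              formUnitaryGroup (J3 u) ⧸ hyperspecialSubgroup R (J3 u))) * Q +
        Polynomial.C
          ((((doubleCosetOp k (hyperspecialSubgroup R (J3 u)) (cellU hϖ hs u 1) *
              doubleCosetOp k (hyperspecialSubgroup R (J3 u)) (cellU hϖ hs u (n + 1)) :
              heckeAlgebra k (hyperspecialSubgroup R (J3 u))) :
              Module.End k (MonoidAlgebra k (formUnitaryGroup (J3 u) ⧸ hyperspecialSubgroup R (J3 u))))
            (MonoidAlgebra.single ((1 : formUnitaryGroup (J3 u)) :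
              formUnitaryGroup (J3 u) ⧸ hyperspecialSubgroup R (J3 u)) 1)).coeff
            ((cellU hϖ hs u n : formUnitaryGroup (J3 u)) :
              formUnitaryGroup (J3 u) ⧸ hyperspecialSubgroup R (J3 u))) * P :=
  X_mul_eq_of_mul_eq (heckeBasisCells hstar u hsu hu0 hu hu' hϖ hs k)
    (heckeBasisCells_zero hstar u hsu hu0 hu hu' hϖ hs k)
    (mul_sub_mem_span hstar u hsu hu0 hu hu' hϖ hs k)
    (mul_cellU_eq_three_term hstar u hsu hu0 hu hu' hϖ hs k n) hP hQ hS

end ThreeTerm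

end Summit.Ventures.HodgeRepro2.T5InertThreeTermRecurrence
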